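import Summits.NavierStokesRegularity.NavierStokesRegularity.Theses.TypeIIInviscidRelaxation
import Summits.NavierStokesRegularity.NavierStokesRegularity.Theorems.TypeIIInviscidRelaxationAxisymSwirlRegularCoreStrainNearTop
import HarnessLib

/-!
# Line `subcritical_core_reynolds` for crux `OneSidedRadialCriterion` (stmt-NavierStokesRegularity-19059)

LINE-FIRST SKELETON (linewriter-ns-typeiiinviscid-1, g1 — third door; g0 registered `parabolic_core_partial_typeI`
(velocity envelope), g1 registered `sub_typeI_core_compression` (strain rate)).  The crux: an axisymmetric classical
Leray–Hopf solution on `[0,T)` (bounded on closed sub-slabs, rapidly decaying datum) with the one-sided gate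
`r u_r ≥ -Cν` on an axis tube `{r < δ}` — inflow Reynolds number `r u_r⁻/ν ≤ C`, ANY `C` — extends smoothly past `T`.

IDEA (self-improvement of the gate constant below the critical-sink threshold, INSIDE the viscous core only).
`C < 2` is a tree theorem (`ScenarioCensus.LogGate.oneSidedRadialCriterion_of_lt_two`: below `2` the swirl
drift–diffusion comparison has a modulus at the axis); at `C ≥ 2` the comparison fails
(`RadialInflowCriticalSink.not_uniform_modulus`).  The tree's TWO-LEVEL criterion
(`RadialInflowCoreReynolds.exists_coreWidth_twoLevelReynolds`: core level `d₀ < 2`, ANY outer level `Λ₀`) shows that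
the threshold `2` matters only inside a viscous-parabolic core `r < ξ₀√(ν(T-t))`: outside it any Reynolds level is
harmless.  Its near-top / thin-tube form exists in the tree only for `d₀ = 1`
(`RadialInflowCoreStrain.exists_coreWidth_twoLevel_tube_nearTop`); §1 below PROVES it for every `d₀ ∈ (0,2)` by the
same Leray-similarity argument.  Hence the crux is EQUIVALENT (given the tree) to the research stub

  `stub_subcriticalCoreReynolds` [research, L]: under the gate (any `C`), there is a level `d₀ < 2` such that for
  EVERY core width `ξ > 0`, from some time `T₁ < T` on, the inflow Reynolds number is `≤ d₀` at the core points
  `0 < r < δ`, `r < ξ√(ν(T-t))`:  `u_r ≥ -ν d₀/r` there.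

"The gate constant self-improves from `C` to SUBCRITICAL (`< 2`) inside every parabolic core near the blow-up time."
NECESSITY: a solution smooth past `T` with `‖∇u‖ ≤ G` on the tube near `T` has `r u_r⁻/ν ≤ G r²/ν ≤ G ξ²(T-t) → 0`,
so nothing is lost by `∀ ξ` or by any fixed `d₀ > 0`.  This is the WEAKEST of the three doors: the strain clause of
`sub_typeI_core_compression` (`κ = 1/ξ²`) and the envelope of `parabolic_core_partial_typeI` each imply it near the
axis, not conversely.  It is the door for hands working with the DRIFT–DIFFUSION structure of `Γ = r u_θ`
(`∂_t Γ + b·∇Γ = ν(Δ - (2/r)∂_r)Γ`): the effective radial drift `u_r - ν/r` is subcritical exactly when `r u_r⁻/ν < 2`.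

Registered stub: `stub_subcriticalCoreReynolds` [research, L].  §1 (`twoLevel_tube_nearTop_of_coreLevel`) and the
composition `OneSidedRadialCriterion_of` are sorry-free.
-/

noncomputable section

namespace Summit.NavierStokesRegularity.NavierStokesRegularity.Cruxes.OneSidedRadialCriterion.SubcriticalCoreReynolds

open Set Real
open Literature.Analysis.FluidPDE
open Summit.NavierStokesRegularity.NavierStokesRegularity.Theorems
open Summit.NavierStokesRegularity.NavierStokesRegularity.Theorems.RadialInflowCoreReynolds
open Summit.NavierStokesRegularity.NavierStokesRegularity.Theorems.RadialInflowCoreStrain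
open Summit.NavierStokesRegularity.NavierStokesRegularity.Theorems.RadialInflowSimilarity
open Summit.NavierStokesRegularity.NavierStokesRegularity.Theorems.ScenarioCensus.LogGate

-- the problem directory repeats the summit name (`NavierStokesRegularity/NavierStokesRegularity`)
set_option linter.dupNamespace false

/-! ## §1 The two-level criterion with core level `d₀ < 2`, on a thin tube, near the blow-up time (PROVED) -/

/-- **Two-level inflow criterion with an arbitrary subcritical core level, thin tube, near the blow-up time**
[assembly, PROVED — the tree's `exists_coreWidth_twoLevel_tube_nearTop` is the case `d₀ = 1`].  For every
`0 < d₀ < 2` and `Λ₀ > 0` there is a core width `ξ₀ > 0` such that in the standing class (with the sub-slab bound):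
if for SOME `δ > 0` and SOME `T₁ < T` the radial velocity obeys, on `{0 < r ≤ δ} × [T₁,T)`, `u_r ≥ -ν d₀/r` where
`r < ξ₀√(ν(T-t))` and `u_r ≥ -νΛ₀/r` where `r ≥ ξ₀√(ν(T-t))`, then the solution extends smoothly past `T`.
Proof: as in the tree (`d₀ = 1`): with `B` the velocity bound on `[0, max T₁ 0]` and `c = min δ (d₀ν/(B⁺+1))`, on
`{0 < r ≤ c}` the Reynolds number is `≤ d₀` up to time `max T₁ 0`, so both clauses hold there from `t = 0` with outer
level `max Λ₀ d₀`; Leray's similarity with `c` maps them onto the unit-tube hypotheses of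
`exists_coreWidth_twoLevelReynolds`. -/
theorem twoLevel_tube_nearTop_of_coreLevel {d₀ Λ₀ : ℝ} (hd0 : 0 < d₀) (hd2 : d₀ < 2) (hΛ : 0 < Λ₀) :
    ∃ ξ₀ : ℝ, 0 < ξ₀ ∧ ∀ (ν T : ℝ), 0 < ν → 0 < T →
      ∀ (u : ℝ → EuclideanSpace ℝ (Fin 3) → EuclideanSpace ℝ (Fin 3)) (p : ℝ → EuclideanSpace ℝ (Fin 3) → ℝ),
      IsClassicalNSSolutionOn (Ico 0 T) ν 0 u p → IsLerayHopfOn T ν 0 (u 0) u → HasRapidSpatialDecay (u 0) →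
      (∀ T' < T, ∃ M : ℝ, ∀ t ∈ Icc 0 T', ∀ x, ‖u t x‖ ≤ M) → (∀ t ∈ Ico 0 T, IsAxisymmetric (u t)) →
      ∀ (δ T₁ : ℝ), 0 < δ → T₁ < T →
      (∀ t ∈ Ico 0 T, T₁ ≤ t → ∀ x : EuclideanSpace ℝ (Fin 3), 0 < cylRadius x → cylRadius x ≤ δ →
        ξ₀ * √(ν * (T - t)) ≤ cylRadius x → -(ν * Λ₀ / cylRadius x) ≤ radialVelocity (u t) x) →
      (∀ t ∈ Ico 0 T, T₁ ≤ t → ∀ x : EuclideanSpace ℝ (Fin 3), 0 < cylRadius x → cylRadius x ≤ δ →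
        cylRadius x < ξ₀ * √(ν * (T - t)) → -(ν * d₀ / cylRadius x) ≤ radialVelocity (u t) x) →
      HasSmoothExtensionPast ν 0 u T := by
  have hΛ1 : 0 < max Λ₀ d₀ := lt_of_lt_of_le hd0 (le_max_right _ _)
  obtain ⟨ξ₀, hξ₀, H⟩ := exists_coreWidth_twoLevelReynolds (d₀ := d₀) (Λ₀ := max Λ₀ d₀) hd0 hd2 hΛ1
  refine ⟨ξ₀, hξ₀, fun ν T hν hT u p hcl hLH hdec hbd hax δ T₁ hδ hT₁ hfar hcore => ?_⟩
  -- the early bound and the thin tube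
  set T₀ : ℝ := max T₁ 0 with hT₀_def
  have hT₀T : T₀ < T := max_lt hT₁ hT
  obtain ⟨B, hB⟩ := hbd T₀ hT₀T
  set B' : ℝ := max B 0 + 1 with hB'_def
  have hB'0 : 0 < B' := by rw [hB'_def]; positivity
  have hBB' : B ≤ B' := by rw [hB'_def]; linarith [le_max_left B 0]
  set c : ℝ := min δ (d₀ * ν / B') with hc_def
  have hc : 0 < c := lt_min hδ (div_pos (mul_pos hd0 hν) hB'0)
  have hcδ : c ≤ δ := min_le_left _ _
  have hcB : c * B' ≤ d₀ * ν := by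
    have h1 : c ≤ d₀ * ν / B' := min_le_right _ _
    rwa [le_div_iff₀ hB'0] at h1
  -- both clauses on the thin tube `{0 < r ≤ c}` from `t = 0`
  have hearly : ∀ t ∈ Ico 0 T, t < T₀ → ∀ x : EuclideanSpace ℝ (Fin 3), 0 < cylRadius x → cylRadius x ≤ c →
      -(ν * d₀ / cylRadius x) ≤ radialVelocity (u t) x := by
    intro t ht htT₀ x hx hxc
    have hu : ‖u t x‖ ≤ B := hB t ⟨ht.1, htT₀.le⟩ x
    have h1 := neg_norm_le_radialVelocity (u t) hx
    have h2 : ‖u t x‖ ≤ ν * d₀ / cylRadius x := by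
      rw [le_div_iff₀ hx]
      calc ‖u t x‖ * cylRadius x ≤ B' * c := by
            refine mul_le_mul (hu.trans hBB') hxc (cylRadius_nonneg x) hB'0.le
        _ ≤ ν * d₀ := by linarith [mul_comm c B', mul_comm ν d₀]
    linarith
  have hcore' : ∀ t ∈ Ico 0 T, ∀ x : EuclideanSpace ℝ (Fin 3), 0 < cylRadius x → cylRadius x ≤ c →
      cylRadius x < ξ₀ * √(ν * (T - t)) → -(ν * d₀ / cylRadius x) ≤ radialVelocity (u t) x := by
    intro t ht x hx hxc hxcore
    by_cases htT₀ : t < T₀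
    · exact hearly t ht htT₀ x hx hxc
    · push Not at htT₀
      exact hcore t ht ((le_max_left _ _).trans htT₀) x hx (hxc.trans hcδ) hxcore
  have hfar' : ∀ t ∈ Ico 0 T, ∀ x : EuclideanSpace ℝ (Fin 3), 0 < cylRadius x → cylRadius x ≤ c →
      ξ₀ * √(ν * (T - t)) ≤ cylRadius x → -(ν * max Λ₀ d₀ / cylRadius x) ≤ radialVelocity (u t) x := by
    intro t ht x hx hxc hxfar
    have hmono : -(ν * max Λ₀ d₀ / cylRadius x) ≤ -(ν * d₀ / cylRadius x) := by
      rw [neg_le_neg_iff]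
      refine div_le_div_of_nonneg_right ?_ hx.le
      exact mul_le_mul_of_nonneg_left (le_max_right _ _) hν.le
    by_cases htT₀ : t < T₀
    · exact hmono.trans (hearly t ht htT₀ x hx hxc)
    · push Not at htT₀
      have h1 := hfar t ht ((le_max_left _ _).trans htT₀) x hx (hxc.trans hcδ) hxfar
      have hmono' : -(ν * max Λ₀ d₀ / cylRadius x) ≤ -(ν * Λ₀ / cylRadius x) := by
        rw [neg_le_neg_iff]
        refine div_le_div_of_nonneg_right ?_ hx.le
        exact mul_le_mul_of_nonneg_left (le_max_left _ _) hν.le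
      exact hmono'.trans h1
  -- Leray's similarity with `c`: the thin tube becomes the unit tube
  have hc2 : 0 < c ^ 2 := pow_pos hc 2
  have hTc : 0 < T / c ^ 2 := div_pos hT hc2
  have hmem : ∀ s ∈ Ico 0 (T / c ^ 2), c ^ 2 * s ∈ Ico 0 T := fun s hs =>
    ⟨mul_nonneg hc2.le hs.1, (lt_div_iff₀' hc2).1 hs.2⟩
  obtain ⟨hclw, hLHw, hdecw, haxw⟩ := standingClass_nsRescale hT hcl hLH hdec hax hc
  -- dictionary between `(s, y)` and `(t, x) = (c² s, c y)`
  have hrad : ∀ y : EuclideanSpace ℝ (Fin 3), cylRadius (c • y) = c * cylRadius y := fun y => by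
    rw [cylRadius_smul, abs_of_pos hc]
  have hsqrt : ∀ s : ℝ, s < T / c ^ 2 → c * √(ν * (T / c ^ 2 - s)) = √(ν * (T - c ^ 2 * s)) := by
    intro s hs
    have e : ν * (T - c ^ 2 * s) = c ^ 2 * (ν * (T / c ^ 2 - s)) := by field_simp
    rw [e, Real.sqrt_mul (sq_nonneg c), Real.sqrt_sq hc.le]
  have hextw : HasSmoothExtensionPast ν 0 (nsRescale c u) (T / c ^ 2) := by
    refine H ν (T / c ^ 2) hν hTc (nsRescale c u) (nsRescalePressure c p) hclw hLHw hdecw haxw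
      (fun s hs y hy hy1 hycore => ?_) (fun s hs y hy hy1 hyfar => ?_)
    · -- core clause
      have hx : 0 < cylRadius (c • y) := by rw [hrad]; exact mul_pos hc hy
      have hxc : cylRadius (c • y) ≤ c := by rw [hrad]; nlinarith
      have hxcore : cylRadius (c • y) < ξ₀ * √(ν * (T - c ^ 2 * s)) := by
        rw [hrad, ← hsqrt s hs.2]
        nlinarith [mul_lt_mul_of_pos_left hycore hc]
      have h1 := hcore' (c ^ 2 * s) (hmem s hs) (c • y) hx hxc hxcore
      rw [radialVelocity_nsRescale hc]
      have e : ν * d₀ / cylRadius y = c * (ν * d₀ / cylRadius (c • y)) := by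
        rw [hrad]; field_simp
      rw [e]
      nlinarith
    · -- far clause
      have hx : 0 < cylRadius (c • y) := by rw [hrad]; exact mul_pos hc hy
      have hxc : cylRadius (c • y) ≤ c := by rw [hrad]; nlinarith
      have hxfar : ξ₀ * √(ν * (T - c ^ 2 * s)) ≤ cylRadius (c • y) := by
        rw [hrad, ← hsqrt s hs.2]
        nlinarith [mul_le_mul_of_nonneg_left hyfar hc.le]
      have h1 := hfar' (c ^ 2 * s) (hmem s hs) (c • y) hx hxc hxfar
      rw [radialVelocity_nsRescale hc]
      have e : ν * max Λ₀ d₀ / cylRadius y = c * (ν * max Λ₀ d₀ / cylRadius (c • y)) := by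
        rw [hrad]; field_simp
      rw [e]
      nlinarith
  -- scale back with `c⁻¹`
  exact hasSmoothExtensionPast_of_nsRescale hc hextw

/-! ## §2 The registered research stub and the composition -/

/-- **stub_subcriticalCoreReynolds** [research, L — the whole content of the crux after localisation to the
parabolic core, in REYNOLDS-NUMBER currency; the weakest of the three doors].
Under the crux's hypotheses (classical on `[0,T)`, Leray–Hopf, bounded on closed sub-slabs, axisymmetric slices,
rapidly decaying datum) and the gate `r u_r ≥ -Cν` on `{r < δ} × [0,T)` (any `C`): there is a SUBCRITICAL level
`d₀ < 2` such that for every core width `ξ > 0` there is a time `T₁ < T` from which on the inflow Reynolds number is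
at most `d₀` at all core points: `u_r(t,x) ≥ -ν d₀ / r` for `T₁ ≤ t < T`, `0 < r < δ`, `r < ξ√(ν(T-t))`.
(Necessary for every solution smooth past `T`, where the core Reynolds number tends to `0`.)  Why it might fail:
nothing known forces the inflow Reynolds number below the critical-sink value `2` in the viscous core — a focusing
event may hold `r u_r ≈ -Cν`, `C ≥ 2`, down to the Kolmogorov radius `r ∼ ν/‖u(t)‖_∞ ≪ √(ν(T-t))`; at level `≥ 2`
the exact sink drifts of `RadialInflowCriticalSink` carry no modulus (tree `not_uniform_modulus`).  Sources:
KNSS2009 (arXiv:0709.3599) §5; LeiZhang2017 (arXiv:1505.04311); Wei2016 (arXiv:1508.02134); Zhang 2026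
(arXiv:2604.07785); tree `RadialInflowCoreReynolds.exists_coreWidth_twoLevelReynolds`. -/
theorem stub_subcriticalCoreReynolds {ν T : ℝ} (hν : 0 < ν) (hT : 0 < T)
    {u : ℝ → EuclideanSpace ℝ (Fin 3) → EuclideanSpace ℝ (Fin 3)} {p : ℝ → EuclideanSpace ℝ (Fin 3) → ℝ}
    (hcl : IsClassicalNSSolutionOn (Ico 0 T) ν 0 u p) (hLH : IsLerayHopfOn T ν 0 (u 0) u)
    (hbd : ∀ T' < T, ∃ M : ℝ, ∀ t ∈ Icc 0 T', ∀ x, ‖u t x‖ ≤ M)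
    (hax : ∀ t ∈ Ico 0 T, IsAxisymmetric (u t)) (hdec : HasRapidSpatialDecay (u 0))
    {C δ : ℝ} (hδ : 0 < δ)
    (hgate : ∀ t ∈ Ico 0 T, ∀ x : EuclideanSpace ℝ (Fin 3), cylRadius x < δ →
      -(C * ν) ≤ x 0 * u t x 0 + x 1 * u t x 1) :
    ∃ d₀ : ℝ, 0 < d₀ ∧ d₀ < 2 ∧ ∀ ξ : ℝ, 0 < ξ → ∃ T₁ : ℝ, T₁ < T ∧
      ∀ t ∈ Ico 0 T, T₁ ≤ t → ∀ x : EuclideanSpace ℝ (Fin 3), 0 < cylRadius x → cylRadius x < δ →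
        cylRadius x < ξ * √(ν * (T - t)) → -(ν * d₀ / cylRadius x) ≤ radialVelocity (u t) x := by
  sorry

/-- **Composition** (sorry-free outside the stub): the crux `OneSidedRadialCriterion` BY NAME.  The gate gives the
outer Reynolds level `max C 1` on the half tube `r ≤ δ/2`; the stub gives the subcritical core level `d₀ < 2` from
some `T₁` on in the core of width `ξ₀(d₀, max C 1)`; §1 concludes. -/
theorem OneSidedRadialCriterion_of :
    Summit.NavierStokesRegularity.NavierStokesRegularity.Theses.TypeIIInviscidRelaxation.OneSidedRadialCriterion := by
  intro ν T hν hT u p hcl hLH hbd hax hdec hin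
  obtain ⟨C, δ, hδ, hgate⟩ := hin
  obtain ⟨d₀, hd0, hd2, Hξ⟩ := stub_subcriticalCoreReynolds hν hT hcl hLH hbd hax hdec hδ hgate
  have hΛ : 0 < max C 1 := lt_of_lt_of_le one_pos (le_max_right _ _)
  obtain ⟨ξ₀, hξ₀, H⟩ := twoLevel_tube_nearTop_of_coreLevel hd0 hd2 hΛ
  obtain ⟨T₁, hT₁, hcore⟩ := Hξ ξ₀ hξ₀
  refine H ν T hν hT u p hcl hLH hdec hbd hax (δ / 2) T₁ (half_pos hδ) hT₁
    (fun t ht _ x hx hxδ _ => ?_) (fun t ht htT₁ x hx hxδ hxcore => hcore t ht htT₁ x hx (by linarith) hxcore)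
  -- the gate gives the Reynolds gate `max C 1` on `r ≤ δ/2 < δ`
  have h1 := hgate t ht x (by linarith)
  rw [radialVelocity_eq_div']
  have h2 : -(ν * max C 1 / cylRadius x) ≤ -(C * ν) / cylRadius x := by
    rw [neg_div]
    refine neg_le_neg (div_le_div_of_nonneg_right ?_ hx.le)
    nlinarith [le_max_left C 1]
  exact h2.trans (div_le_div_of_nonneg_right h1 hx.le)

end Summit.NavierStokesRegularity.NavierStokesRegularity.Cruxes.OneSidedRadialCriterion.SubcriticalCoreReynolds

end
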